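import Literature.MathematicalPhysics.QuantumFieldTheory.Balaban1983to89.T3CruxEstimates
import HarnessLib

/-!
# R3 (cell `ym3-torus`, YM₃ on T³ — a ladder RUNG, NOT d = 4, NOT the Clay problem), UV3-node side of the 19936 deep-heights target
# `PlanPinned41.stub_pinnedRatio` (= LEAD's `hP`) — **THE (Z-DOOR): THE GIBBS PROBABILITY OF A HISTORY EVENT «`Ū^i U ∈ C_i` FOR ALL `i ≤ j`»
# FROM TWO Z-LEVEL BOUNDS ON THE FAMILY'S OWN RENORMALISED DENSITY TOWER — AN A.E. BOUND ON THE HISTORY-WEIGHTED («PINNED») TOWER AND A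
# LOWER BOUND ON THE PARTITION INTEGRAL, WITH A SHARED VACUUM-ENERGY CONSTANT**

Seat `ym3-torus-px13` g11 (width copy of `ym3-torus-p1` = R3's UV-stability node).  THEOREMS ONLY (0 `def`, 0 `sorry`);
`--supports stmt-QuantumFields-19936 --as helper`; count-neutral.  ★★OWNER WORD 47 (iii)(α) ∕ ideator ym-r3-idea-2 g16 PLAN v1.1 (α′): «the Z-level →
probability dictionary door … so the registered stub's antecedent currency is fixed» — this file IS that door, in the TREE'S letters: the
renormalised densities `ρ_k = emlDensity F γ K k` of the `K`-th approximation CONSTRUCTED over the family's own (0.4)∕`ℰp` averaging (lit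
✓`T3UnitLawDensityEML` §1: `rt F K k _ : RTOpI …` = the Radon–Nikodym renormalization transformation (2) at level `k`, push-forward identity
`integral_emlDensity_mul`) and the Gibbs measure `gibbsK F ℰp γ K` (lit ✓`T4GenFunBounds.integral_gibbsMeasure`).

THE PRINT.  [Balaban1985UV3] (1)–(2) p. 256, (6)–(8) pp. 257–258 (decomposition of unity by the CURRENT field's own plaquettes at `ε₁ = g_kp(g_k)` = tree
`θBal F.L γ b₀ p₀ k`; the sum over histories), (41) p. 266 ∕ (47) p. 267 (upper∕lower bounds with the SAME vacuum energy `E_k`, (64)), (5) p. 256.  The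
probability statement is NOT printed (print bounds densities only); this file is the bookkeeping that turns two density-level bounds into it.
THE HISTORY-WEIGHTED («PINNED») TOWER (no `def`: a hypothesis-described sequence): for measurable weight sets `C i` and a height `j`,
`σ 0 = 𝟙_{C 0}·ρ₀`, `σ (i+1) = 𝟙_{C (i+1)}·T_i σ_i` for `i + 1 ≤ j` ((7)'s characteristic functions inserted level by level, as in (41)), and
`σ (i+1) = T_i σ_i` for `i ≥ j` (free transport by the SAME `T_i = (rt F K i _).T`).  Then `∫ σ_k dV_k = ∫ ρ₀·𝟙{∀ i ≤ j, Ū^i U ∈ C i} dU = Z_K·Gibbs_K{…}`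
for `k ≥ j`, so an A.E. bound on `σ_K` («S-step»: pinned (41) + (70)∕(71) + ✓`UV3PinnedLargeFieldResummation`) and a LOWER bound on `∫ ρ_K = Z_K`
(«S-low»: (47)∕(5)) with a SHARED `E` give the tail.

WHAT IS PROVED (ns `…Theorems.UV3PinnedRatioOfTowerBounds`; `F : T3Family`, `0 ≤ γ`, run `K`).
* §1 `indicator_histEvent_zero` ∕ `indicator_histEvent_succ` (the history indicator factorises level by level), `measurableSet_histEvent`,
  ★ `integrable_pinnedTower` (every level `≤ m + K`), ★★ `integral_pinnedTower_mul` — THE WEIGHTED PUSH-FORWARD: for `i ≤ j` and bounded measurable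
  `f`, `∫ σ_i·f dV_i = ∫ ρ₀(U)·𝟙{∀ i' ≤ i, Ū^{i'}U ∈ C i'}·f(Ū^iU) dU` (induction; lit `RTOpI.isRT` of `rt` with the test function `𝟙_{C}·f`),
  ★★ `integral_pinnedTower_eq` (`∫ σ_k dV_k = ∫ ρ₀·𝟙{history} dU` for `j ≤ k ≤ m + K`), ★ `integral_emlDensity_eq_partitionFn` ((6): `∫ ρ_k dV_k = Z_K`).
* §2 ★★★ `gibbsK_real_histEvent_le_of_towerBounds` — THE DOOR: for a level `k ∈ [j, K]`, reals `E Cu Cl w`, `0 ≤ w`: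
  (Z-UP-PIN) `∀ᵐ V ∂dV_k, σ k V ≤ exp(−E + Cu)·w`  ∧  (Z-LOW) `exp(−E − Cl) ≤ ∫ ρ_k dV_k`  ⟹  `Gibbs_K{U | ∀ i ≤ j, Ū^i U ∈ C i} ≤ exp(Cu + Cl)·w`.
* §3 ★★★ `gibbsK_real_pinnedConditioned_le_of_towerBounds` — THE DOOR AT `hP`'S EVENT (`PlanPinned41.stub_pinnedRatio` v1.1 = LEAD's K-19 `hP`): with
  `C i = {PlaqSmall (θBal … (K − i))}` for `i < j` (the finest-bad-level CONDITIONER — the histories a pinned (41) reads: all finer decompositions small)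
  and `C j = {V | θBal … (K − j) ≤ dist1 (V(∂a))}` (plaquette `a` of the `j`-fold averaged field is (7)-LARGE), the conclusion is, token for token in
  `hP`'s letters, `(gibbsK F ℰp γ K).real ({U | θBal F.L γ b₀ p₀ (K − j) ≤ dist1 (plaqHol (Ū^j U) a)} ∩ {U | ∀ i, i < j → PlaqSmall (θBal F.L γ b₀ p₀ (K − i))
  (Ū^i U)}) ≤ exp(Cu + Cl)·w` for ANY `w ≥ 0` — instantiate `w := β_{K−j}^A·exp(−c·p(g_{K−j})²)`; `Cu, Cl` after `F, γ` (volume-extensive allowed: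
  px8 g10 SCOPE FACT «VOLUME», LEAD v15).
THE ANTECEDENT CURRENCY OF (α′) IS THEREBY FIXED: S-step := (Z-UP-PIN) for the `C`-weighted tower at the unit lattice (XL: the UV3 node's Sect. C
leaf bundle re-instantiated with (7) restricted, LOCATE `LOCATE-PINNED41-ON-UV3-NODE-px13g11.md` §3; resummation half ✓`UV3PinnedLargeFieldResummation`,
constant `c = c₁∕8`); S-low := (Z-LOW) ((47)∕(5)_K integrated over the small-field window, SAME `E`); S-dict is ABSORBED — the pin «`a` large for
`Ū^jU`» IS the weight `𝟙_{C j}` (the (7) decomposition acts on the averaged field's own plaquettes; px8 g10's note).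

HONEST SCOPE.  Measure-theoretic bookkeeping over the constructed tower; NO bound of [Balaban1985UV3] is proved: (Z-UP-PIN), (Z-LOW),
`stub_pinnedRatio`∕`hP`∕`hW`∕`hG`, `HistoryTailL` (19936), K1 (23532), (Q), UV3's Tier A∕B∕E are NOT proved; nothing continuum ∕ OS ∕ mass-gap ∕ Clay.
References: T. Bałaban, CMP **102** (1985) 255–275 [Balaban1985UV3] ((1)–(2), (5) p. 256; (6)–(8) pp. 257–258; (41) p. 266; (47) p. 267; (64) p. 273);
T. Bałaban, *Averaging operations for lattice gauge theories*, CMP **98** (1985) 17–51 [Balaban1985Averaging] ((10) p. 19).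
-/

set_option autoImplicit false

noncomputable section

namespace Summit.QuantumFields.YangMills.Theorems.UV3PinnedRatioOfTowerBounds

open MeasureTheory
open Literature.MathematicalPhysics.QuantumFieldTheory.Balaban1983to89
open Literature.MathematicalPhysics.QuantumFieldTheory.Balaban1983to89.T3ContinuumYM3Torus
open Literature.MathematicalPhysics.QuantumFieldTheory.Balaban1983to89.Missing (boltzmann partitionFn measurable_plaqHol
  isProbabilityMeasure_fieldMeasure partitionFn_pos')
open Literature.MathematicalPhysics.QuantumFieldTheory.Balaban1983to89.T3UnitLawDensityEML (ℰp measurableE_ℰp emlDensity rt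
  measurable_blockAvg haarAC_blockAvg emlDensity_zero integrable_emlDensity integral_emlDensity_mul)
open Literature.MathematicalPhysics.QuantumFieldTheory.Balaban1983to89.T3UnitScaleTilt (gibbsK gibbsK_eq θBal)

variable (F : T3Family) {γ : ℝ} (K : ℕ)

/-! ## §1 The history event, the pinned tower, and the weighted push-forward identity -/

/-- The history event «`Ū^i U ∈ C i` for all `i ≤ 0`» is «`U ∈ C 0`» (`Ū^0 = id`): indicator form. [cite: Balaban1985UV3, (7) p.257] -/
theorem indicator_histEvent_zero (C : (i : ℕ) → Set (GaugeField (F.P K) i (Matrix.specialUnitaryGroup (Fin 2) ℂ)))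
    (U : GaugeField (F.P K) 0 (Matrix.specialUnitaryGroup (Fin 2) ℂ)) :
    Set.indicator {U : GaugeField (F.P K) 0 (Matrix.specialUnitaryGroup (Fin 2) ℂ) |
        ∀ i, i ≤ 0 → Averaging.iter (fun i' => BlockAveraging.blockAvg (P := F.P K) (j := i') ℰp) i U ∈ C i}
      (1 : GaugeField (F.P K) 0 (Matrix.specialUnitaryGroup (Fin 2) ℂ) → ℝ) U = (C 0).indicator 1 U := by
  have hiff : U ∈ {U : GaugeField (F.P K) 0 (Matrix.specialUnitaryGroup (Fin 2) ℂ) |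
      ∀ i, i ≤ 0 → Averaging.iter (fun i' => BlockAveraging.blockAvg (P := F.P K) (j := i') ℰp) i U ∈ C i} ↔ U ∈ C 0 := by
    simp only [Set.mem_setOf_eq, Nat.le_zero]
    constructor
    · intro h; exact h 0 rfl
    · intro h i hi; subst hi; exact h
  by_cases hU : U ∈ C 0
  · rw [Set.indicator_of_mem (hiff.mpr hU), Set.indicator_of_mem hU]
  · rw [Set.indicator_of_notMem (mt hiff.mp hU), Set.indicator_of_notMem hU]

/-- The history indicator FACTORISES level by level: `𝟙{∀ i' ≤ i+1, Ū^{i'}U ∈ C i'} = 𝟙{∀ i' ≤ i, …} · 𝟙_{C (i+1)}(Ū^{i+1} U)`.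
[cite: Balaban1985UV3, (7)–(8) pp.257–258] -/
theorem indicator_histEvent_succ (C : (i : ℕ) → Set (GaugeField (F.P K) i (Matrix.specialUnitaryGroup (Fin 2) ℂ))) (i : ℕ)
    (U : GaugeField (F.P K) 0 (Matrix.specialUnitaryGroup (Fin 2) ℂ)) :
    Set.indicator {U : GaugeField (F.P K) 0 (Matrix.specialUnitaryGroup (Fin 2) ℂ) |
        ∀ i', i' ≤ i + 1 → Averaging.iter (fun i'' => BlockAveraging.blockAvg (P := F.P K) (j := i'') ℰp) i' U ∈ C i'}
      (1 : GaugeField (F.P K) 0 (Matrix.specialUnitaryGroup (Fin 2) ℂ) → ℝ) U =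
      Set.indicator {U : GaugeField (F.P K) 0 (Matrix.specialUnitaryGroup (Fin 2) ℂ) |
          ∀ i', i' ≤ i → Averaging.iter (fun i'' => BlockAveraging.blockAvg (P := F.P K) (j := i'') ℰp) i' U ∈ C i'}
        (1 : GaugeField (F.P K) 0 (Matrix.specialUnitaryGroup (Fin 2) ℂ) → ℝ) U *
      (C (i + 1)).indicator 1 (Averaging.iter (fun i'' => BlockAveraging.blockAvg (P := F.P K) (j := i'') ℰp) (i + 1) U) := by
  set S1 := {U : GaugeField (F.P K) 0 (Matrix.specialUnitaryGroup (Fin 2) ℂ) |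
      ∀ i', i' ≤ i + 1 → Averaging.iter (fun i'' => BlockAveraging.blockAvg (P := F.P K) (j := i'') ℰp) i' U ∈ C i'} with hS1
  set S0 := {U : GaugeField (F.P K) 0 (Matrix.specialUnitaryGroup (Fin 2) ℂ) |
      ∀ i', i' ≤ i → Averaging.iter (fun i'' => BlockAveraging.blockAvg (P := F.P K) (j := i'') ℰp) i' U ∈ C i'} with hS0
  have hiff : U ∈ S1 ↔ U ∈ S0 ∧
      Averaging.iter (fun i'' => BlockAveraging.blockAvg (P := F.P K) (j := i'') ℰp) (i + 1) U ∈ C (i + 1) := by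
    simp only [hS1, hS0, Set.mem_setOf_eq]
    constructor
    · intro h
      exact ⟨fun i' hi' => h i' (Nat.le_succ_of_le hi'), h (i + 1) le_rfl⟩
    · rintro ⟨h0, h1⟩ i' hi'
      rcases Nat.lt_or_eq_of_le hi' with hlt | heq
      · exact h0 i' (Nat.lt_succ_iff.mp hlt)
      · subst heq; exact h1
  by_cases h0 : U ∈ S0
  · by_cases h1 : Averaging.iter (fun i'' => BlockAveraging.blockAvg (P := F.P K) (j := i'') ℰp) (i + 1) U ∈ C (i + 1)
    · rw [Set.indicator_of_mem (hiff.mpr ⟨h0, h1⟩), Set.indicator_of_mem h0, Set.indicator_of_mem h1]; simp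
    · rw [Set.indicator_of_notMem (fun h => h1 (hiff.mp h).2), Set.indicator_of_notMem h1]; simp
  · rw [Set.indicator_of_notMem (fun h => h0 (hiff.mp h).1), Set.indicator_of_notMem h0]; simp

/-- The history event is measurable (iterated averaging is measurable, lit `T4Continuum.measurable_iter`). [cite: Balaban1987RG1, (0.4)∕(0.11) p.253] -/
theorem measurableSet_histEvent (C : (i : ℕ) → Set (GaugeField (F.P K) i (Matrix.specialUnitaryGroup (Fin 2) ℂ)))
    (hC : ∀ i, MeasurableSet (C i)) (j : ℕ) :
    MeasurableSet {U : GaugeField (F.P K) 0 (Matrix.specialUnitaryGroup (Fin 2) ℂ) |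
      ∀ i, i ≤ j → Averaging.iter (fun i' => BlockAveraging.blockAvg (P := F.P K) (j := i') ℰp) i U ∈ C i} := by
  have hiter : ∀ i, Measurable (Averaging.iter (fun i' => BlockAveraging.blockAvg (P := F.P K) (j := i') ℰp) i) :=
    T4Continuum.measurable_iter _ (measurable_blockAvg F K)
  have heq : {U : GaugeField (F.P K) 0 (Matrix.specialUnitaryGroup (Fin 2) ℂ) |
      ∀ i, i ≤ j → Averaging.iter (fun i' => BlockAveraging.blockAvg (P := F.P K) (j := i') ℰp) i U ∈ C i} =
      ⋂ i : ℕ, {U | i ≤ j → Averaging.iter (fun i' => BlockAveraging.blockAvg (P := F.P K) (j := i') ℰp) i U ∈ C i} := by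
    ext U; simp only [Set.mem_setOf_eq, Set.mem_iInter]
  rw [heq]
  refine MeasurableSet.iInter fun i => ?_
  by_cases hi : i ≤ j
  · have : {U : GaugeField (F.P K) 0 (Matrix.specialUnitaryGroup (Fin 2) ℂ) |
        i ≤ j → Averaging.iter (fun i' => BlockAveraging.blockAvg (P := F.P K) (j := i') ℰp) i U ∈ C i} =
        (Averaging.iter (fun i' => BlockAveraging.blockAvg (P := F.P K) (j := i') ℰp) i) ⁻¹' (C i) := by
      ext U; simp [hi]
    rw [this]
    exact hiter i (hC i)
  · have : {U : GaugeField (F.P K) 0 (Matrix.specialUnitaryGroup (Fin 2) ℂ) |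
        i ≤ j → Averaging.iter (fun i' => BlockAveraging.blockAvg (P := F.P K) (j := i') ℰp) i U ∈ C i} = Set.univ := by
      ext U; simp [hi]
    rw [this]
    exact MeasurableSet.univ

/-- ★ **THE PINNED TOWER IS INTEGRABLE** at every level `≤ m + K`: indicators of integrable densities are integrable and each `T_i` (Radon–Nikodym
transport over a Haar-a.c. averaging) preserves integrability (lit `T4FiniteEpsInhabited.integrable_rnTransport_of_ac`).
[cite: Balaban1985UV3, (2) p.256 and (6) p.257; Balaban1985Averaging, (10) p.19] -/
theorem integrable_pinnedTower (hγ : 0 ≤ γ) (C : (i : ℕ) → Set (GaugeField (F.P K) i (Matrix.specialUnitaryGroup (Fin 2) ℂ)))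
    (hC : ∀ i, MeasurableSet (C i)) (j : ℕ) (σ : (k : ℕ) → Density (F.P K) k (Matrix.specialUnitaryGroup (Fin 2) ℂ))
    (hσ0 : σ 0 = (C 0).indicator (emlDensity F γ K 0))
    (hσw : ∀ (i : ℕ) (h : i + 1 ≤ F.m + K), i + 1 ≤ j → σ (i + 1) = (C (i + 1)).indicator ((rt F K i h).T (σ i)))
    (hσf : ∀ (i : ℕ) (h : i + 1 ≤ F.m + K), j ≤ i → σ (i + 1) = (rt F K i h).T (σ i)) :
    ∀ k : ℕ, k ≤ F.m + K → Integrable (σ k) (fieldMeasure (F.P K) k (Matrix.specialUnitaryGroup (Fin 2) ℂ)) := by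
  intro k hk
  induction k with
  | zero =>
    rw [hσ0]
    exact (integrable_emlDensity F K hγ 0 hk).indicator (hC 0)
  | succ k ih =>
    have hT : Integrable ((rt F K k hk).T (σ k)) (fieldMeasure (F.P K) (k + 1) (Matrix.specialUnitaryGroup (Fin 2) ℂ)) :=
      T4FiniteEpsInhabited.integrable_rnTransport_of_ac _ (measurable_blockAvg F K k) (haarAC_blockAvg F K hk) _ (ih (by omega))
    by_cases hkj : k + 1 ≤ j
    · rw [hσw k hk hkj]
      exact hT.indicator (hC (k + 1))
    · rw [hσf k hk (by omega)]
      exact hT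

/-- ★★ **THE WEIGHTED PUSH-FORWARD IDENTITY** (the heart of the door): for `i ≤ j`, `i ≤ m + K`, and every bounded measurable `f` on level-`i` fields,
`∫ σ_i(V)·f(V) dV_i = ∫ ρ₀(U)·𝟙{∀ i' ≤ i, Ū^{i'}U ∈ C i'}·f(Ū^i U) dU` — (2)∕(6) with the test function `𝟙_{C}·f` (lit `RTOpI.isRT` of `rt`), the history
indicator accumulating one level at a time exactly as (7)'s characteristic functions do in (41). [cite: Balaban1985UV3, (2) p.256, (6)–(8) pp.257–258, (41) p.266] -/
theorem integral_pinnedTower_mul (hγ : 0 ≤ γ) (C : (i : ℕ) → Set (GaugeField (F.P K) i (Matrix.specialUnitaryGroup (Fin 2) ℂ)))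
    (hC : ∀ i, MeasurableSet (C i)) (j : ℕ) (σ : (k : ℕ) → Density (F.P K) k (Matrix.specialUnitaryGroup (Fin 2) ℂ))
    (hσ0 : σ 0 = (C 0).indicator (emlDensity F γ K 0))
    (hσw : ∀ (i : ℕ) (h : i + 1 ≤ F.m + K), i + 1 ≤ j → σ (i + 1) = (C (i + 1)).indicator ((rt F K i h).T (σ i)))
    (hσf : ∀ (i : ℕ) (h : i + 1 ≤ F.m + K), j ≤ i → σ (i + 1) = (rt F K i h).T (σ i)) :
    ∀ i : ℕ, i ≤ j → i ≤ F.m + K →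
      ∀ f : GaugeField (F.P K) i (Matrix.specialUnitaryGroup (Fin 2) ℂ) → ℝ, Measurable f → (∃ B : ℝ, ∀ V, |f V| ≤ B) →
        ∫ V, σ i V * f V ∂fieldMeasure (F.P K) i (Matrix.specialUnitaryGroup (Fin 2) ℂ) =
          ∫ U, emlDensity F γ K 0 U *
            (Set.indicator {U : GaugeField (F.P K) 0 (Matrix.specialUnitaryGroup (Fin 2) ℂ) |
                ∀ i', i' ≤ i → Averaging.iter (fun i'' => BlockAveraging.blockAvg (P := F.P K) (j := i'') ℰp) i' U ∈ C i'}
              (1 : GaugeField (F.P K) 0 (Matrix.specialUnitaryGroup (Fin 2) ℂ) → ℝ) U *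
             f (Averaging.iter (fun i'' => BlockAveraging.blockAvg (P := F.P K) (j := i'') ℰp) i U))
            ∂fieldMeasure (F.P K) 0 (Matrix.specialUnitaryGroup (Fin 2) ℂ) := by
  intro i hij hi
  induction i with
  | zero =>
    intro f _ _
    refine integral_congr_ae (Filter.Eventually.of_forall fun U => ?_)
    show σ 0 U * f U = emlDensity F γ K 0 U * (Set.indicator _ 1 U * f (Averaging.iter _ 0 U))
    rw [hσ0, indicator_histEvent_zero F K C U]
    show (C 0).indicator (emlDensity F γ K 0) U * f U = emlDensity F γ K 0 U * ((C 0).indicator 1 U * f U)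
    by_cases hU : U ∈ C 0
    · rw [Set.indicator_of_mem hU, Set.indicator_of_mem hU]; simp
    · rw [Set.indicator_of_notMem hU, Set.indicator_of_notMem hU]; simp
  | succ i ih =>
    intro f hf hB
    obtain ⟨B, hB⟩ := hB
    have hij' : i ≤ j := by omega
    have hi' : i ≤ F.m + K := by omega
    -- the test function `𝟙_{C (i+1)} · f`, bounded and measurable
    set g : GaugeField (F.P K) (i + 1) (Matrix.specialUnitaryGroup (Fin 2) ℂ) → ℝ := fun V => (C (i + 1)).indicator 1 V * f V with hgdef
    have hgm : Measurable g := (measurable_one.indicator (hC (i + 1))).mul hf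
    have hgB : ∀ V, |g V| ≤ |B| := by
      intro V
      have h1 : |(C (i + 1)).indicator (1 : GaugeField (F.P K) (i + 1) (Matrix.specialUnitaryGroup (Fin 2) ℂ) → ℝ) V| ≤ 1 := by
        by_cases hV : V ∈ C (i + 1)
        · rw [Set.indicator_of_mem hV]; simp
        · rw [Set.indicator_of_notMem hV]; simp
      have h2 := hB V
      rw [hgdef, abs_mul]
      calc |(C (i + 1)).indicator (1 : GaugeField (F.P K) (i + 1) (Matrix.specialUnitaryGroup (Fin 2) ℂ) → ℝ) V| * |f V|
          ≤ 1 * |B| := mul_le_mul h1 (h2.trans (le_abs_self B)) (abs_nonneg _) zero_le_one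
        _ = |B| := one_mul _
    -- insert the weight, transport, apply the induction hypothesis to `g ∘ avg_i`
    have hw : ∀ V, σ (i + 1) V * f V = (rt F K i hi).T (σ i) V * g V := by
      intro V
      rw [hσw i hi hij]
      by_cases hV : V ∈ C (i + 1)
      · rw [Set.indicator_of_mem hV, hgdef]; simp only [Set.indicator_of_mem hV, Pi.one_apply, one_mul]
      · rw [Set.indicator_of_notMem hV, hgdef]; simp only [Set.indicator_of_notMem hV, zero_mul, mul_zero]
    have hint := integrable_pinnedTower F K hγ C hC j σ hσ0 hσw hσf i hi'
    have step := (rt F K i hi).isRT (σ i) hint g hgm ⟨|B|, hgB⟩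
    rw [integral_congr_ae (Filter.Eventually.of_forall hw), step,
      ih hij' hi' (fun U => g ((BlockAveraging.blockAvg (P := F.P K) (j := i) ℰp).avg U)) (hgm.comp (measurable_blockAvg F K i))
        ⟨|B|, fun U => hgB _⟩]
    refine integral_congr_ae (Filter.Eventually.of_forall fun U => ?_)
    show emlDensity F γ K 0 U * (Set.indicator _ 1 U * g ((BlockAveraging.blockAvg (P := F.P K) (j := i) ℰp).avg
        (Averaging.iter (fun i'' => BlockAveraging.blockAvg (P := F.P K) (j := i'') ℰp) i U))) =
      emlDensity F γ K 0 U * (Set.indicator _ 1 U * f (Averaging.iter _ (i + 1) U))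
    rw [indicator_histEvent_succ F K C i U, hgdef]
    show emlDensity F γ K 0 U * (Set.indicator _ 1 U *
        ((C (i + 1)).indicator 1 (Averaging.iter (fun i'' => BlockAveraging.blockAvg (P := F.P K) (j := i'') ℰp) (i + 1) U) *
          f (Averaging.iter (fun i'' => BlockAveraging.blockAvg (P := F.P K) (j := i'') ℰp) (i + 1) U))) = _
    ring

/-- ★★ **THE PINNED TOWER KEEPS ITS MASS ABOVE THE PINNED LEVEL**: `∫ σ_k dV_k = ∫ ρ₀(U)·𝟙{∀ i ≤ j, Ū^i U ∈ C i} dU` for `j ≤ k ≤ m + K`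
(§1's identity at `i = j`, `f ≡ 1`, then (2)∕(6) with `f ≡ 1` for the free transports). [cite: Balaban1985UV3, (2) p.256 and (6) p.257] -/
theorem integral_pinnedTower_eq (hγ : 0 ≤ γ) (C : (i : ℕ) → Set (GaugeField (F.P K) i (Matrix.specialUnitaryGroup (Fin 2) ℂ)))
    (hC : ∀ i, MeasurableSet (C i)) (j : ℕ) (σ : (k : ℕ) → Density (F.P K) k (Matrix.specialUnitaryGroup (Fin 2) ℂ))
    (hσ0 : σ 0 = (C 0).indicator (emlDensity F γ K 0))
    (hσw : ∀ (i : ℕ) (h : i + 1 ≤ F.m + K), i + 1 ≤ j → σ (i + 1) = (C (i + 1)).indicator ((rt F K i h).T (σ i)))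
    (hσf : ∀ (i : ℕ) (h : i + 1 ≤ F.m + K), j ≤ i → σ (i + 1) = (rt F K i h).T (σ i)) :
    ∀ k : ℕ, j ≤ k → k ≤ F.m + K →
      ∫ V, σ k V ∂fieldMeasure (F.P K) k (Matrix.specialUnitaryGroup (Fin 2) ℂ) =
        ∫ U, emlDensity F γ K 0 U *
            Set.indicator {U : GaugeField (F.P K) 0 (Matrix.specialUnitaryGroup (Fin 2) ℂ) |
                ∀ i', i' ≤ j → Averaging.iter (fun i'' => BlockAveraging.blockAvg (P := F.P K) (j := i'') ℰp) i' U ∈ C i'}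
              (1 : GaugeField (F.P K) 0 (Matrix.specialUnitaryGroup (Fin 2) ℂ) → ℝ) U
          ∂fieldMeasure (F.P K) 0 (Matrix.specialUnitaryGroup (Fin 2) ℂ) := by
  intro k hjk hk
  induction k with
  | zero =>
    obtain rfl : j = 0 := Nat.le_zero.mp hjk
    have h := integral_pinnedTower_mul F K hγ C hC 0 σ hσ0 hσw hσf 0 le_rfl hk (fun _ => 1) measurable_const ⟨1, fun _ => by simp⟩
    simp only [mul_one] at h
    exact h
  | succ k ih =>
    rcases Nat.lt_or_eq_of_le hjk with hlt | heq
    · have hjk' : j ≤ k := Nat.lt_succ_iff.mp hlt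
      have hint := integrable_pinnedTower F K hγ C hC j σ hσ0 hσw hσf k (by omega)
      have step := (rt F K k hk).isRT (σ k) hint (fun _ => (1 : ℝ)) measurable_const ⟨1, fun _ => by simp⟩
      simp only [mul_one] at step
      rw [hσf k hk hjk', step]
      exact ih hjk' (by omega)
    · subst heq
      have h := integral_pinnedTower_mul F K hγ C hC (k + 1) σ hσ0 hσw hσf (k + 1) le_rfl hk (fun _ => 1) measurable_const
        ⟨1, fun _ => by simp⟩
      simp only [mul_one] at h
      exact h

/-- ★ **(6): THE UN-PINNED TOWER INTEGRATES TO THE PARTITION FUNCTION** at every level `k ≤ m + K`: `∫ ρ_k dV_k = Z_K = ∫ e^{−β_K A} dU`.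
[cite: Balaban1985UV3, (6) p.257] -/
theorem integral_emlDensity_eq_partitionFn (hγ : 0 ≤ γ) (k : ℕ) (hk : k ≤ F.m + K) :
    ∫ V, emlDensity F γ K k V ∂fieldMeasure (F.P K) k (Matrix.specialUnitaryGroup (Fin 2) ℂ) =
      partitionFn (G := Matrix.specialUnitaryGroup (Fin 2) ℂ) (F.P K) ((F.scheme ℰp γ).β K) := by
  have h := integral_emlDensity_mul F K hγ k hk (fun _ => (1 : ℝ)) measurable_const ⟨1, fun _ => by simp⟩
  simp only [mul_one] at h
  rw [h, partitionFn]

/-! ## §2 THE DOOR — history events -/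

/-- ★★★ **THE (Z-DOOR).**  Let `C i` be measurable weight sets of level-`i` fields of the `K`-th approximation (`0 ≤ γ`), `j ≤ k ≤ K`, `σ` the pinned
tower of `C` up to height `j` (free transport after), and `E Cu Cl w` reals with `0 ≤ w`.  IF (Z-UP-PIN) `σ_k ≤ exp(−E + Cu)·w` `dV_k`-A.E. at level `k` (a.e., not pointwise:
the tower is a Radon–Nikodym version), and (Z-LOW) `exp(−E − Cl) ≤ ∫ ρ_k dV_k` (the SAME `E`: the vacuum energy cancels), THEN `Gibbs_K{U | ∀ i ≤ j, Ū^i U ∈ C i} ≤ exp(Cu + Cl)·w`.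
Proof: the Gibbs probability is `(∫ ρ₀·𝟙{history})∕Z_K` (lit `integral_gibbsMeasure`), the numerator is `∫ σ_k ≤ exp(−E+Cu)·w` (§1 + Haar mass `1`),
`Z_K = ∫ ρ_k ≥ exp(−E−Cl)` (§1 (6)). [cite: Balaban1985UV3, (2) p.256, (6)–(8) pp.257–258, (41) p.266, (47) p.267] -/
theorem gibbsK_real_histEvent_le_of_towerBounds (hγ : 0 ≤ γ)
    (C : (i : ℕ) → Set (GaugeField (F.P K) i (Matrix.specialUnitaryGroup (Fin 2) ℂ))) (hC : ∀ i, MeasurableSet (C i))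
    {j : ℕ} (σ : (k : ℕ) → Density (F.P K) k (Matrix.specialUnitaryGroup (Fin 2) ℂ))
    (hσ0 : σ 0 = (C 0).indicator (emlDensity F γ K 0))
    (hσw : ∀ (i : ℕ) (h : i + 1 ≤ F.m + K), i + 1 ≤ j → σ (i + 1) = (C (i + 1)).indicator ((rt F K i h).T (σ i)))
    (hσf : ∀ (i : ℕ) (h : i + 1 ≤ F.m + K), j ≤ i → σ (i + 1) = (rt F K i h).T (σ i))
    {k : ℕ} (hjk : j ≤ k) (hkK : k ≤ K) {E Cu Cl w : ℝ} (hw : 0 ≤ w)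
    (hUP : ∀ᵐ V ∂fieldMeasure (F.P K) k (Matrix.specialUnitaryGroup (Fin 2) ℂ), σ k V ≤ Real.exp (-E + Cu) * w)
    (hLOW : Real.exp (-E - Cl) ≤ ∫ V, emlDensity F γ K k V ∂fieldMeasure (F.P K) k (Matrix.specialUnitaryGroup (Fin 2) ℂ)) :
    (gibbsK F ℰp γ K).real
        {U : GaugeField (F.P K) 0 (Matrix.specialUnitaryGroup (Fin 2) ℂ) |
          ∀ i, i ≤ j → Averaging.iter (fun i' => BlockAveraging.blockAvg (P := F.P K) (j := i') ℰp) i U ∈ C i}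
      ≤ Real.exp (Cu + Cl) * w := by
  have hkm : k ≤ F.m + K := by omega
  haveI := isProbabilityMeasure_fieldMeasure (G := Matrix.specialUnitaryGroup (Fin 2) ℂ) (F.P K) k
  set S := {U : GaugeField (F.P K) 0 (Matrix.specialUnitaryGroup (Fin 2) ℂ) |
      ∀ i, i ≤ j → Averaging.iter (fun i' => BlockAveraging.blockAvg (P := F.P K) (j := i') ℰp) i U ∈ C i} with hS
  have hSm : MeasurableSet S := measurableSet_histEvent F K C hC j
  set Z : ℝ := partitionFn (G := Matrix.specialUnitaryGroup (Fin 2) ℂ) (F.P K) ((F.scheme ℰp γ).β K) with hZdef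
  have hZpos : 0 < Z := partitionFn_pos' (G := Matrix.specialUnitaryGroup (Fin 2) ℂ) (F.P K) (F.scheme_β_nonneg ℰp hγ K)
  -- the Gibbs probability as a ratio of Z-level integrals
  have hratio : (gibbsK F ℰp γ K).real S =
      (∫ U, S.indicator 1 U * boltzmann (F.P K) ((F.scheme ℰp γ).β K) U
          ∂fieldMeasure (F.P K) 0 (Matrix.specialUnitaryGroup (Fin 2) ℂ)) / Z := by
    rw [← integral_indicator_one hSm, gibbsK_eq, T4GenFunBounds.integral_gibbsMeasure _ (F.scheme_β_nonneg ℰp hγ K)]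
  -- numerator = the pinned tower's mass at level k ≤ exp(−E + Cu)·w
  have hnum : ∫ U, S.indicator 1 U * boltzmann (F.P K) ((F.scheme ℰp γ).β K) U
      ∂fieldMeasure (F.P K) 0 (Matrix.specialUnitaryGroup (Fin 2) ℂ) ≤ Real.exp (-E + Cu) * w := by
    have hmass := integral_pinnedTower_eq F K hγ C hC j σ hσ0 hσw hσf k hjk hkm
    have hcomm : ∫ U, S.indicator 1 U * boltzmann (F.P K) ((F.scheme ℰp γ).β K) U
        ∂fieldMeasure (F.P K) 0 (Matrix.specialUnitaryGroup (Fin 2) ℂ) =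
        ∫ V, σ k V ∂fieldMeasure (F.P K) k (Matrix.specialUnitaryGroup (Fin 2) ℂ) := by
      rw [hmass]
      refine integral_congr_ae (Filter.Eventually.of_forall fun U => ?_)
      show S.indicator 1 U * boltzmann (F.P K) ((F.scheme ℰp γ).β K) U = emlDensity F γ K 0 U * S.indicator 1 U
      rw [emlDensity_zero, mul_comm]
    rw [hcomm]
    have hint := integrable_pinnedTower F K hγ C hC j σ hσ0 hσw hσf k hkm
    calc ∫ V, σ k V ∂fieldMeasure (F.P K) k (Matrix.specialUnitaryGroup (Fin 2) ℂ)
        ≤ ∫ _V, Real.exp (-E + Cu) * w ∂fieldMeasure (F.P K) k (Matrix.specialUnitaryGroup (Fin 2) ℂ) :=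
          integral_mono_ae hint (integrable_const _) hUP
      _ = Real.exp (-E + Cu) * w := by rw [integral_const, smul_eq_mul, probReal_univ, one_mul]
  -- denominator: Z_K = ∫ ρ_k ≥ exp(−E − Cl)
  have hden : Real.exp (-E - Cl) ≤ Z := by
    rw [hZdef, ← integral_emlDensity_eq_partitionFn F K hγ k hkm]
    exact hLOW
  rw [hratio, div_le_iff₀ hZpos]
  have h1 : Real.exp (-E + Cu) * w = Real.exp (Cu + Cl) * w * Real.exp (-E - Cl) := by
    rw [mul_assoc, mul_comm w, ← mul_assoc, ← Real.exp_add]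
    congr 1
    congr 1
    ring
  have h2 : Real.exp (Cu + Cl) * w * Real.exp (-E - Cl) ≤ Real.exp (Cu + Cl) * w * Z :=
    mul_le_mul_of_nonneg_left hden (mul_nonneg (Real.exp_pos _).le hw)
  linarith [hnum, h1, h2]

/-! ## §3 THE DOOR at `hP`'s event: plaquette `a` of `Ū^j U` (7)-large, all finer levels (7)-small -/

/-- ★★★ **THE (Z-DOOR) AT THE EVENT OF `PlanPinned41.stub_pinnedRatio` v1.1 = LEAD's K-19 `hP`.**  For the `K`-th approximation (`0 ≤ γ`), a height
`j ≤ K`, a plaquette `a` of the level-`j` torus, profile parameters `b₀ p₀`, and weight sets `C` with `C i = {PlaqSmall (θBal F.L γ b₀ p₀ (K − i))}` for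
`i < j` (the CONDITIONER: every finer averaged field (7)-small) and `C j = {V | θBal F.L γ b₀ p₀ (K − j) ≤ dist1 (V(∂a))}` (the PIN: `a` is (7)-large for
`Ū^jU`): IF the pinned tower `σ` of `C` obeys (Z-UP-PIN) `σ_k ≤ exp(−E + Cu)·w` `dV_k`-a.e. at a level `k ∈ [j, K]` and (Z-LOW) `exp(−E − Cl) ≤ ∫ ρ_k dV_k`
with the SAME `E`, THEN — token for token the measured set of `hP` —
`(gibbsK F ℰp γ K).real ({U | θBal … (K − j) ≤ dist1 (plaqHol (Ū^j U) a)} ∩ {U | ∀ i, i < j → PlaqSmall (θBal … (K − i)) (Ū^i U)}) ≤ exp(Cu + Cl)·w`.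
Instantiate `w := β_{K−j}^A·exp(−c·p(g_{K−j})²)` for `hP`'s right-hand side; (Z-UP-PIN) is S-step's output slot, (Z-LOW) is S-low's; neither is proved here.
[cite: Balaban1985UV3, (2) p.256, (5) p.256, (6)–(8) pp.257–258, (41) p.266, (47) p.267, (71) p.273] -/
theorem gibbsK_real_pinnedConditioned_le_of_towerBounds (hγ : 0 ≤ γ) (b₀ p₀ : ℝ) {j : ℕ} (a : Plaq (F.P K) j)
    (C : (i : ℕ) → Set (GaugeField (F.P K) i (Matrix.specialUnitaryGroup (Fin 2) ℂ))) (hC : ∀ i, MeasurableSet (C i))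
    (hClt : ∀ i, i < j → C i = {V | PlaqSmall (θBal F.L γ b₀ p₀ (K - i)) V})
    (hCj : C j = {V | θBal F.L γ b₀ p₀ (K - j) ≤ GaugeGroup.dist1 (GaugeField.plaqHol V a)})
    (σ : (k : ℕ) → Density (F.P K) k (Matrix.specialUnitaryGroup (Fin 2) ℂ))
    (hσ0 : σ 0 = (C 0).indicator (emlDensity F γ K 0))
    (hσw : ∀ (i : ℕ) (h : i + 1 ≤ F.m + K), i + 1 ≤ j → σ (i + 1) = (C (i + 1)).indicator ((rt F K i h).T (σ i)))
    (hσf : ∀ (i : ℕ) (h : i + 1 ≤ F.m + K), j ≤ i → σ (i + 1) = (rt F K i h).T (σ i))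
    {k : ℕ} (hjk : j ≤ k) (hkK : k ≤ K) {E Cu Cl w : ℝ} (hw : 0 ≤ w)
    (hUP : ∀ᵐ V ∂fieldMeasure (F.P K) k (Matrix.specialUnitaryGroup (Fin 2) ℂ), σ k V ≤ Real.exp (-E + Cu) * w)
    (hLOW : Real.exp (-E - Cl) ≤ ∫ V, emlDensity F γ K k V ∂fieldMeasure (F.P K) k (Matrix.specialUnitaryGroup (Fin 2) ℂ)) :
    (gibbsK F ℰp γ K).real
        ({U : GaugeField (F.P K) 0 (Matrix.specialUnitaryGroup (Fin 2) ℂ) |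
            θBal F.L γ b₀ p₀ (K - j) ≤ GaugeGroup.dist1 (GaugeField.plaqHol
              (Averaging.iter (fun i' => BlockAveraging.blockAvg (P := F.P K) (j := i') ℰp) j U) a)} ∩
          {U : GaugeField (F.P K) 0 (Matrix.specialUnitaryGroup (Fin 2) ℂ) | ∀ i, i < j →
            PlaqSmall (θBal F.L γ b₀ p₀ (K - i))
              (Averaging.iter (fun i' => BlockAveraging.blockAvg (P := F.P K) (j := i') ℰp) i U)})
      ≤ Real.exp (Cu + Cl) * w := by
  have hev : ({U : GaugeField (F.P K) 0 (Matrix.specialUnitaryGroup (Fin 2) ℂ) |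
            θBal F.L γ b₀ p₀ (K - j) ≤ GaugeGroup.dist1 (GaugeField.plaqHol
              (Averaging.iter (fun i' => BlockAveraging.blockAvg (P := F.P K) (j := i') ℰp) j U) a)} ∩
          {U : GaugeField (F.P K) 0 (Matrix.specialUnitaryGroup (Fin 2) ℂ) | ∀ i, i < j →
            PlaqSmall (θBal F.L γ b₀ p₀ (K - i))
              (Averaging.iter (fun i' => BlockAveraging.blockAvg (P := F.P K) (j := i') ℰp) i U)}) =
      {U : GaugeField (F.P K) 0 (Matrix.specialUnitaryGroup (Fin 2) ℂ) |
          ∀ i, i ≤ j → Averaging.iter (fun i' => BlockAveraging.blockAvg (P := F.P K) (j := i') ℰp) i U ∈ C i} := by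
    ext U
    simp only [Set.mem_inter_iff, Set.mem_setOf_eq]
    constructor
    · rintro ⟨hlarge, hsmall⟩ i hi
      rcases Nat.lt_or_eq_of_le hi with hlt | heq
      · rw [hClt i hlt]; exact hsmall i hlt
      · subst heq; rw [hCj]; exact hlarge
    · intro h
      refine ⟨?_, fun i hi => ?_⟩
      · have hj := h j le_rfl
        rw [hCj] at hj
        exact hj
      · have hi' := h i hi.le
        rw [hClt i hi] at hi'
        exact hi'
  rw [hev]
  exact gibbsK_real_histEvent_le_of_towerBounds F K hγ C hC σ hσ0 hσw hσf hjk hkK hw hUP hLOW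

end Summit.QuantumFields.YangMills.Theorems.UV3PinnedRatioOfTowerBounds

end
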